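import Summits.BirchSwinnertonDyer.BirchSwinnertonDyer.Theorems.QuadraticBranchSignedControlPlusEtaNonsurjFineRoadUnitAnchor
import Summits.BirchSwinnertonDyer.BirchSwinnertonDyer.Theorems.QuadraticBranchSignedControlPlusEtaNonsurjFineRoadRecordsA
import Summits.BirchSwinnertonDyer.BirchSwinnertonDyer.Theorems.QuadraticBranchSignedControlPlusEtaNonsurjFineRoadRecordsB
import Summits.BirchSwinnertonDyer.BirchSwinnertonDyer.Theorems.QuadraticBranchSignedControlPlusEtaNonsurjCMUnitRecordShape
import Summits.BirchSwinnertonDyer.Rank1Residual.X11b.KrausMinimalityGeneralTwo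
import HarnessLib

/-!
# Route `QuadraticBranchSignedControl` (rung K8, cell `bsd-potss`), residual crux `PlusEtaMainConjectureNonsurj`
# (stmt-BirchSwinnertonDyer-19606): per-row RECORDS through CM UNIT SIBLINGS — the classes of 675a1 and 14400l1 (3 Tamagawa rank-0 rows, 1 prime-L rank-1 row) (FINE ROAD part 6, seat k8eta-c2 g7)

WHAT. Seat k8eta-c2 g6 recorded the 7 Tamagawa rank-`0` rows of crux 19606 (and mapped the 5 prime-`L` rank-`1` non-CM rows
78300bd1, 159300h1, 417600gp1, 341775cf1, 341775dm1) through the rank-`1` CM anchors 2700p1 / 675a1 / 14400l1 / 11025b1 of their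
mod-`5` congruence classes, with statement (A) AT THE ANCHOR DISPLAYED (`hA'`: a Deo–Ray–Sujatha 2023 Thm. 3.7 certificate resting on the
analytic input «`Ш(anchor)[5] = 0`», for which no Kolyvagin/Cha certificate exists — FINDING-19606-k8eta-c2-g6 §3/§6 (3)). THIS FILE removes
that input: by Fisher's theorem on the Hesse pencils `X_E(5)` / `X_E^{{(2)}}(5)` (every curve `5`-congruent to a `j = 0` curve `E`
lies in one of two explicit genus-`0` families; kit j280663 / j281329 / j281456, seat k8eta-c2 g7) each of these classes contains a
RANK-`0` CM SIBLING `A` of the same conductor (the point `(0:1)` of a family of the anchor: class of 675a1: `A = [0,0,1,0,-169]`, the point `(0:1)` of `X_{675a1}^{(2)}(5)`; class of 14400l1: `A = [0,0,0,0,800]`, the point `(0:1)` of `X_{14400l1}(5)`), with `r_an(A) = 0`,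
`#Ш(A)_an = 1`, `5 ∤ Tam(A)·#A(ℚ)_tors` — a CM UNIT ANCHOR. For such an anchor statement (A) at `(A, 5)` is a TREE THEOREM of the
K9 lane modulo bsd.S28 = Burungale–Flach + modularity (`WildFineSelmerCMFineUnitAnchor.conjA_rat_of_cmFineUnitData_tamagawa`), it
transfers to the row by Lim–Sujatha 2018 Prop. 3.2 (PROVED, `EtaFineRoad.conjA_of_torsionIso_of_conjA`), and the fine road
(`EtaFineRoad`, parts 2–4, modulo Kobayashi's Thm. 6.2/6.3/7.3 i) at `η`) concludes: per-row instances of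
`EtaFineRoad.quadraticBranchPlusEtaMainConjectureAt_of_congruent_cmUnitAnchor_of_shaAn_unit` (rank-`0` rows) and
`EtaFineRoad.quadraticBranchPlusEtaMainConjectureAt_of_span_eq_span_X_of_congruent_cmUnitAnchor` (prime-`L` rank-`1` rows).
KERNEL content: `Δ ≠ 0`, global minimality (Kraus/Silverman criterion on the support of `Δ`) and CM (`j = 0 ∈` the thirteen CM
`j`-invariants, `hasCM_iff_j_mem_holds`) of the sibling anchors; `Δ ≠ 0` / minimality of the rows (re-used from parts A/B where landed).
DISPLAYED per row: the torsion isomorphism `hcong` (provenance: two points of Fisher's families of the rank-`1` anchor — the row and the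
sibling — both `5`-congruent to it BY THEOREM [Fisher 2012 Thm. 13.2; Fisher 2013 Thm. 5.8]; no Kraus–Oesterlé trace certificate is
needed), the sibling's `r_an = 0` / `#Ш_an = 1` / `5 ∤ Tam` (Cremona/PARI, kit j281329), its local test at `5` (`hlocp`, `hS`: no `D_5`-fixed
`5`-torsion — true on every curve `5`-congruent to a Gss2 partner by the inertia argument of FINDING-g6 §2, displayed as in the K9 files),
the row's `L(W,1) ≠ 0` / `#Ш(W)_an` (rank `0`) or `r_an(W) = 1` / `(L_p⁺(V,η,X)) = (X)` (rank `1`), and the analytic `μ` (rank `0`).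

HONEST FRAMING (cell `bsd-potss`; FULL-BSD rank ≤ 1 programme, HUMAN RULING D-0036/D-0074): per-row RECORDS, CONDITIONAL on the
displayed named facts (`hPT hmod hGZK h22 h41 hKO h6273 hS28`) and the displayed per-row inputs listed above; no stub of 19606 is proved
by name; the crux stays OPEN; nothing is booked; `BSD(W,5)` is claimed for no pair. `--supports stmt-BirchSwinnertonDyer-19606`.

References: [Fisher2012Hessian] T. Fisher, The Hessian of a genus one curve, Proc. LMS 104 (2012), Thm. 13.2 and §8; [Fisher2013QuinticI]
T. Fisher, Invariant theory for the elliptic normal quintic I. Twists of X(5), Math. Ann. 356 (2013), Thm. 5.8; [LimSujatha2018] §3 Prop. 3.2;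
[BurungaleFlach2024] Thm. 1.1, Cor. 2; [GreenbergLNM1716] Prop. 3.8; [Kobayashi2003] §4 (p. 8), Thm. 7.3 i) (p. 13); [Cremona1997] Table 1;
[SilvermanAEC2009] VII.1 Rem. 1.1, App. C §11; [Kraus1989] Prop. 1–2.
-/

set_option autoImplicit false
set_option linter.dupNamespace false

noncomputable section

open scoped Classical

open CongruenceSubgroup Field Function NumberField IsDedekindDomain WeierstrassCurve
open Literature.NumberTheory.EllipticCurves
open Literature.NumberTheory.EllipticCurves.ModularForms
open Literature.NumberTheory.EllipticCurves.Rank1Residual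
open Literature.NumberTheory.GaloisRepresentations
open Literature.NumberTheory.GaloisCohomology
open Literature.NumberTheory.EllipticCurves.GreenbergVatsal2000
open Literature.NumberTheory.EllipticCurves.GreenbergSelmer (decomp)
open Summit.BirchSwinnertonDyer.Rank1Residual.X11b
open Summit.BirchSwinnertonDyer.Rank1Residual.Additive

namespace Summit.BirchSwinnertonDyer.BirchSwinnertonDyer.Theorems

namespace EtaFineRoadRecords

/-! ## §0 Kernel facts: the rank-`0` CM siblings (unit anchors) and the rank-`1` rows -/

/-- The rank-`0` CM sibling `A = [0, 0, 1, 0, -169]` of the class of `675a1` (point `(0:1)` of the indirect family `X_{675a1}^{(2)}(5)`; `N = 675`): `Δ ≠ 0` (kernel).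
[cite: Fisher2013QuinticI, Thm. 5.8] [cite: Fisher2012Hessian, Thm. 13.2] -/
theorem isElliptic_A675 : (⟨0, 0, 1, 0, (-169)⟩ : WeierstrassCurve ℚ).IsElliptic :=
  isElliptic_of_discOf_ne_zero 0 0 1 0 (-169) (by decide +kernel)

set_option maxRecDepth 100000 in
/-- `A = [0, 0, 1, 0, -169]` is a global minimal equation (Silverman/Kraus criterion on the support of `Δ`, kernel).
[cite: SilvermanAEC2009, VII.1 Remark 1.1] [cite: Kraus1989, Prop. 1 and Prop. 2] -/
theorem isGloballyMinimal_A675 : (⟨0, 0, 1, 0, (-169)⟩ : WeierstrassCurve ℚ).IsGloballyMinimal :=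
  isGloballyMinimal_of_krausCriterion_support 0 0 1 0 (-169) [(3, 3, 9), (5, 2, 4)]
    (by decide +kernel) (by decide +kernel) (by decide +kernel)

set_option maxRecDepth 100000 in
/-- `A = [0, 0, 1, 0, -169]` has CM: `j(A) = c₄³/Δ = 0` is one of the thirteen CM `j`-invariants (kernel, through the tree theorem
`hasCM_iff_j_mem_holds`). [cite: SilvermanAEC2009, Appendix C §11] -/
theorem hasCM_A675 : (⟨0, 0, 1, 0, (-169)⟩ : WeierstrassCurve ℚ).HasCM := by
  have hj := @EtaUnitRows.ratCurve_j 0 0 1 0 (-169) isElliptic_A675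
  push_cast at hj
  haveI := isElliptic_A675
  exact (hasCM_iff_j_mem_holds _).mpr (by rw [hj]; decide +kernel)

/-- The rank-`0` CM sibling `A = [0, 0, 0, 0, 800]` of the class of `14400l1` (point `(0:1)` of the direct family `X_{14400l1}(5)`; `N = 14400`): `Δ ≠ 0` (kernel).
[cite: Fisher2013QuinticI, Thm. 5.8] [cite: Fisher2012Hessian, Thm. 13.2] -/
theorem isElliptic_A14400 : (⟨0, 0, 0, 0, 800⟩ : WeierstrassCurve ℚ).IsElliptic :=
  isElliptic_of_discOf_ne_zero 0 0 0 0 800 (by decide +kernel)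

set_option maxRecDepth 100000 in
/-- `A = [0, 0, 0, 0, 800]` is a global minimal equation (Silverman/Kraus criterion on the support of `Δ`, kernel).
[cite: SilvermanAEC2009, VII.1 Remark 1.1] [cite: Kraus1989, Prop. 1 and Prop. 2] -/
theorem isGloballyMinimal_A14400 : (⟨0, 0, 0, 0, 800⟩ : WeierstrassCurve ℚ).IsGloballyMinimal :=
  isGloballyMinimal_of_krausCriterion_support 0 0 0 0 800 [(2, 6, 14), (3, 2, 3), (5, 2, 4)]
    (by decide +kernel) (by decide +kernel) (by decide +kernel)

set_option maxRecDepth 100000 in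
/-- `A = [0, 0, 0, 0, 800]` has CM: `j(A) = c₄³/Δ = 0` is one of the thirteen CM `j`-invariants (kernel, through the tree theorem
`hasCM_iff_j_mem_holds`). [cite: SilvermanAEC2009, Appendix C §11] -/
theorem hasCM_A14400 : (⟨0, 0, 0, 0, 800⟩ : WeierstrassCurve ℚ).HasCM := by
  have hj := @EtaUnitRows.ratCurve_j 0 0 0 0 800 isElliptic_A14400
  push_cast at hj
  haveI := isElliptic_A14400
  exact (hasCM_iff_j_mem_holds _).mpr (by rw [hj]; decide +kernel)

/-- `417600gp1` = `[0, 0, 0, -34500, 5157000]`: `Δ ≠ 0` (kernel). [cite: Cremona1997, Table 1 (label 417600gp1)] -/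
theorem isElliptic_417600gp1 : (⟨0, 0, 0, (-34500), 5157000⟩ : WeierstrassCurve ℚ).IsElliptic :=
  isElliptic_of_discOf_ne_zero 0 0 0 (-34500) 5157000 (by decide +kernel)

set_option maxRecDepth 100000 in
/-- `417600gp1` is a global minimal equation (Silverman's criterion on the support of `Δ`, kernel; `v(Δ) < 12` at every bad prime).
[cite: SilvermanAEC2009, VII.1 Remark 1.1] -/
theorem isGloballyMinimal_417600gp1 : (⟨0, 0, 0, (-34500), 5157000⟩ : WeierstrassCurve ℚ).IsGloballyMinimal :=
  isGloballyMinimal_of_krausCriterion_support 0 0 0 (-34500) 5157000 [(2, 6, 10), (3, 2, 3), (5, 2, 6), (29, 1, 5)]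
    (by decide +kernel) (by decide +kernel) (by decide +kernel)

/-! ## §1 Records -/

set_option maxRecDepth 100000 in
/-- **(C1⁺_η) at `p = 5` for every good `a_5 = 0` model `V` of the `5`-twist of `162675n1`** (`N = 162675`; Cremona: `r_an = 0`,
`#Ш_an = 4`; `5 ∣ Tam` — a TAMAGAWA row) through the rank-`0` CM sibling `A = [0, 0, 1, 0, -169]` of its class: the row is the
point `(λ:μ) = (120:1)` of the direct family `X_{675a1}(5)` and `A` the point point `(0:1)` of the indirect family `X_{675a1}^{(2)}(5)` of Fisher's families of `675a1`, so `W[5] ≅ 675a1[5] ≅ A[5]` BY THEOREM (displayed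
`hcong`); `A`: `r_an = 0`, `#Ш_an = 1`, `Tam = 1`, `#A(ℚ)_tors = 1` (displayed `hr hm htam`; kit j281329), local test at `5` displayed (`hS hlocp`); the row's
`L(W,1) ≠ 0`, `#Ш(W)_an = 4` and the analytic `μ` displayed. Statement (A) at the anchor is now the TREE THEOREM
`WildFineSelmerCMFineUnitAnchor.conjA_rat_of_cmFineUnitData_tamagawa` (mod `hS28 hmod`) — no Deo–Ray–Sujatha certificate, no «`Ш[5] = 0`»
input at a rank-`1` anchor, no Hatley–Lei. Per-row instance of
`EtaFineRoad.quadraticBranchPlusEtaMainConjectureAt_of_congruent_cmUnitAnchor_of_shaAn_unit`; CONDITIONAL on `hPT hmod hGZK h22 h41 hKO h6273 hS28`;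
nothing booked. [cite: Fisher2012Hessian, Thm. 13.2] [cite: Fisher2013QuinticI, Thm. 5.8] [cite: LimSujatha2018, §3 Prop. 3.2]
[cite: BurungaleFlach2024, Thm. 1.1 and Cor. 2] [cite: Kobayashi2003, §4 (p. 8)] [cite: Cremona1997, Table 1 (label 162675n1)] -/
theorem etaMC_r0_162675n1_5_cmUnitSibling (hPT : poitouTate_selmerStructure_duality_real ℚ) (hmod : hasEntireLFunction_rat)
    (hGZK : rank_eq_analyticRank_of_analyticRank_le_one)
    (h22 : Kobayashi2003.thm22_etaSignedSelmerDual_finite_torsion)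
    (h41 : Kobayashi2003.thm41_plusEtaCharIdeal_dvd)
    (hKO : KitajimaOtsuki2018.mainThm13_etaSignedSelmerDual_noFiniteSubmodule)
    (h6273 : Kobayashi2003.thm62_63_73_etaColemanPoitouTate) (hS28 : bsdTriple_of_hasCM_of_L_one_ne_zero)
    (W : WeierstrassCurve ℚ) (hW : W = ⟨0, 0, 1, (-10374750), (-13063103719)⟩) (hLW : W.entireLFunction 1 ≠ 0)
    (hs : shaAn W = ((4 : ℕ) : ℚ))
    (A : WeierstrassCurve ℚ) (hA : A = ⟨0, 0, 1, 0, (-169)⟩)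
    (hcong : ∃ e : W.geomTorsion ((5 : ℕ) : ℤ) ≃+ A.geomTorsion ((5 : ℕ) : ℤ),
      ∀ (σ : absoluteGaloisGroup ℚ) (P : W.geomTorsion ((5 : ℕ) : ℤ)), e (σ • P) = σ • e P)
    (hr : A.analyticRank = 0) (hm : shaAn A = ((1 : ℕ) : ℂ)) (htam : ¬ 5 ∣ A.tamagawaProduct)
    (S : Finset (HeightOneSpectrum (𝓞 ℚ))) (hS : ∀ v ∉ S, (((5 : ℕ) : ℕ) : 𝓞 ℚ) ∉ v.asIdeal ∧ A.HasGoodReductionAt v)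
    (hlocp : ∀ v ∈ S, (((5 : ℕ) : ℕ) : 𝓞 ℚ) ∈ v.asIdeal →
      ∀ x : A.geomPrimaryTorsion 5, 5 • x = 0 → (∀ d ∈ decomp v, d • x = x) → x = 0) :
    ∀ (V : WeierstrassCurve ℚ) [V.IsElliptic] [V.IsGloballyMinimal] [Fact (5 : ℕ).Prime],
      (∃ C : VariableChange ℚ, C • W.quadraticTwist (5) = V) →
      V.HasGoodReductionAtPrime 5 → V.frobeniusTrace 5 = 0 →
      (∀ {N : ℕ} [NeZero N] {f : CuspForm (Gamma0 N) 2}, IsNewformOf V f →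
        ∀ (ϖ : ℚ), (if Even (5 / 2) then (ϖ : ℝ) * V.realPeriodRat = plusPeriod f
            else (ϖ : ℝ) * V.imaginaryPeriodRat = minusPeriod f) →
        ∀ (Lη : IwasawaAlgebra 5), IsQuadraticBranchPlusLFunction f 5 ϖ Lη → HasUnitContent Lη) →
        QuadraticBranchPlusEtaMainConjectureAt V 5 := by
  subst hW; subst hA
  intro V _ _ _ hC hgood hap hμan
  obtain ⟨C, hCV⟩ := hC
  haveI := isElliptic_162675n1
  haveI := isGloballyMinimal_162675n1
  haveI := isElliptic_A675
  haveI := isGloballyMinimal_A675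
  have hD : ((-1 : ℚ) ^ ((5 : ℕ) / 2) * ((5 : ℕ) : ℚ)) = 5 := by norm_num
  exact EtaFineRoad.quadraticBranchPlusEtaMainConjectureAt_of_congruent_cmUnitAnchor_of_shaAn_unit _ 5 hPT hmod hGZK h22 h41
    hKO h6273 hS28 V C (le_refl 5) (by rw [hD]; exact hCV) hgood hap hLW (q := ((4 : ℕ) : ℚ)) (by exact_mod_cast hs) (by rw [padicValRat.of_nat]; exact_mod_cast padicValNat.eq_zero_of_not_dvd (by norm_num)) hμan
    _ hcong hasCM_A675 hr hm (by decide) htam S hS hlocp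

set_option maxRecDepth 100000 in
/-- **(C1⁺_η) at `p = 5` for every good `a_5 = 0` model `V` of the `5`-twist of `404325f1`** (`N = 404325`; Cremona: `r_an = 0`,
`#Ш_an = 1`; `5 ∣ Tam` — a TAMAGAWA row) through the rank-`0` CM sibling `A = [0, 0, 1, 0, -169]` of its class: the row is the
point `(λ:μ) = (30:1)` of the direct family `X_{675a1}(5)` and `A` the point point `(0:1)` of the indirect family `X_{675a1}^{(2)}(5)` of Fisher's families of `675a1`, so `W[5] ≅ 675a1[5] ≅ A[5]` BY THEOREM (displayed
`hcong`); `A`: `r_an = 0`, `#Ш_an = 1`, `Tam = 1`, `#A(ℚ)_tors = 1` (displayed `hr hm htam`; kit j281329), local test at `5` displayed (`hS hlocp`); the row's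
`L(W,1) ≠ 0`, `#Ш(W)_an = 1` and the analytic `μ` displayed. Statement (A) at the anchor is now the TREE THEOREM
`WildFineSelmerCMFineUnitAnchor.conjA_rat_of_cmFineUnitData_tamagawa` (mod `hS28 hmod`) — no Deo–Ray–Sujatha certificate, no «`Ш[5] = 0`»
input at a rank-`1` anchor, no Hatley–Lei. Per-row instance of
`EtaFineRoad.quadraticBranchPlusEtaMainConjectureAt_of_congruent_cmUnitAnchor_of_shaAn_unit`; CONDITIONAL on `hPT hmod hGZK h22 h41 hKO h6273 hS28`;
nothing booked. [cite: Fisher2012Hessian, Thm. 13.2] [cite: Fisher2013QuinticI, Thm. 5.8] [cite: LimSujatha2018, §3 Prop. 3.2]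
[cite: BurungaleFlach2024, Thm. 1.1 and Cor. 2] [cite: Kobayashi2003, §4 (p. 8)] [cite: Cremona1997, Table 1 (label 404325f1)] -/
theorem etaMC_r0_404325f1_5_cmUnitSibling (hPT : poitouTate_selmerStructure_duality_real ℚ) (hmod : hasEntireLFunction_rat)
    (hGZK : rank_eq_analyticRank_of_analyticRank_le_one)
    (h22 : Kobayashi2003.thm22_etaSignedSelmerDual_finite_torsion)
    (h41 : Kobayashi2003.thm41_plusEtaCharIdeal_dvd)
    (hKO : KitajimaOtsuki2018.mainThm13_etaSignedSelmerDual_noFiniteSubmodule)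
    (h6273 : Kobayashi2003.thm62_63_73_etaColemanPoitouTate) (hS28 : bsdTriple_of_hasCM_of_L_one_ne_zero)
    (W : WeierstrassCurve ℚ) (hW : W = ⟨0, 0, 1, (-277006500), 1774389583406⟩) (hLW : W.entireLFunction 1 ≠ 0)
    (hs : shaAn W = ((1 : ℕ) : ℚ))
    (A : WeierstrassCurve ℚ) (hA : A = ⟨0, 0, 1, 0, (-169)⟩)
    (hcong : ∃ e : W.geomTorsion ((5 : ℕ) : ℤ) ≃+ A.geomTorsion ((5 : ℕ) : ℤ),
      ∀ (σ : absoluteGaloisGroup ℚ) (P : W.geomTorsion ((5 : ℕ) : ℤ)), e (σ • P) = σ • e P)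
    (hr : A.analyticRank = 0) (hm : shaAn A = ((1 : ℕ) : ℂ)) (htam : ¬ 5 ∣ A.tamagawaProduct)
    (S : Finset (HeightOneSpectrum (𝓞 ℚ))) (hS : ∀ v ∉ S, (((5 : ℕ) : ℕ) : 𝓞 ℚ) ∉ v.asIdeal ∧ A.HasGoodReductionAt v)
    (hlocp : ∀ v ∈ S, (((5 : ℕ) : ℕ) : 𝓞 ℚ) ∈ v.asIdeal →
      ∀ x : A.geomPrimaryTorsion 5, 5 • x = 0 → (∀ d ∈ decomp v, d • x = x) → x = 0) :
    ∀ (V : WeierstrassCurve ℚ) [V.IsElliptic] [V.IsGloballyMinimal] [Fact (5 : ℕ).Prime],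
      (∃ C : VariableChange ℚ, C • W.quadraticTwist (5) = V) →
      V.HasGoodReductionAtPrime 5 → V.frobeniusTrace 5 = 0 →
      (∀ {N : ℕ} [NeZero N] {f : CuspForm (Gamma0 N) 2}, IsNewformOf V f →
        ∀ (ϖ : ℚ), (if Even (5 / 2) then (ϖ : ℝ) * V.realPeriodRat = plusPeriod f
            else (ϖ : ℝ) * V.imaginaryPeriodRat = minusPeriod f) →
        ∀ (Lη : IwasawaAlgebra 5), IsQuadraticBranchPlusLFunction f 5 ϖ Lη → HasUnitContent Lη) →
        QuadraticBranchPlusEtaMainConjectureAt V 5 := by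
  subst hW; subst hA
  intro V _ _ _ hC hgood hap hμan
  obtain ⟨C, hCV⟩ := hC
  haveI := isElliptic_404325f1
  haveI := isGloballyMinimal_404325f1
  haveI := isElliptic_A675
  haveI := isGloballyMinimal_A675
  have hD : ((-1 : ℚ) ^ ((5 : ℕ) / 2) * ((5 : ℕ) : ℚ)) = 5 := by norm_num
  exact EtaFineRoad.quadraticBranchPlusEtaMainConjectureAt_of_congruent_cmUnitAnchor_of_shaAn_unit _ 5 hPT hmod hGZK h22 h41
    hKO h6273 hS28 V C (le_refl 5) (by rw [hD]; exact hCV) hgood hap hLW (q := ((1 : ℕ) : ℚ)) (by exact_mod_cast hs) (by simp) hμan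
    _ hcong hasCM_A675 hr hm (by decide) htam S hS hlocp

set_option maxRecDepth 100000 in
/-- **(C1⁺_η) at `p = 5` for every good `a_5 = 0` model `V` of the `5`-twist of `417600fp1`** (`N = 417600`; Cremona: `r_an = 0`,
`#Ш_an = 1`; `5 ∣ Tam` — a TAMAGAWA row) through the rank-`0` CM sibling `A = [0, 0, 0, 0, 800]` of its class: the row is the
point `(λ:μ) = (-120:1)` of the direct family `X_{14400l1}(5)` and `A` the point point `(0:1)` of the direct family `X_{14400l1}(5)` of Fisher's families of `14400l1`, so `W[5] ≅ 14400l1[5] ≅ A[5]` BY THEOREM (displayed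
`hcong`); `A`: `r_an = 0`, `#Ш_an = 1`, `Tam = 2`, `#A(ℚ)_tors = 1` (displayed `hr hm htam`; kit j281329), local test at `5` displayed (`hS hlocp`); the row's
`L(W,1) ≠ 0`, `#Ш(W)_an = 1` and the analytic `μ` displayed. Statement (A) at the anchor is now the TREE THEOREM
`WildFineSelmerCMFineUnitAnchor.conjA_rat_of_cmFineUnitData_tamagawa` (mod `hS28 hmod`) — no Deo–Ray–Sujatha certificate, no «`Ш[5] = 0`»
input at a rank-`1` anchor, no Hatley–Lei. Per-row instance of
`EtaFineRoad.quadraticBranchPlusEtaMainConjectureAt_of_congruent_cmUnitAnchor_of_shaAn_unit`; CONDITIONAL on `hPT hmod hGZK h22 h41 hKO h6273 hS28`;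
nothing booked. [cite: Fisher2012Hessian, Thm. 13.2] [cite: Fisher2013QuinticI, Thm. 5.8] [cite: LimSujatha2018, §3 Prop. 3.2]
[cite: BurungaleFlach2024, Thm. 1.1 and Cor. 2] [cite: Kobayashi2003, §4 (p. 8)] [cite: Cremona1997, Table 1 (label 417600fp1)] -/
theorem etaMC_r0_417600fp1_5_cmUnitSibling (hPT : poitouTate_selmerStructure_duality_real ℚ) (hmod : hasEntireLFunction_rat)
    (hGZK : rank_eq_analyticRank_of_analyticRank_le_one)
    (h22 : Kobayashi2003.thm22_etaSignedSelmerDual_finite_torsion)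
    (h41 : Kobayashi2003.thm41_plusEtaCharIdeal_dvd)
    (hKO : KitajimaOtsuki2018.mainThm13_etaSignedSelmerDual_noFiniteSubmodule)
    (h6273 : Kobayashi2003.thm62_63_73_etaColemanPoitouTate) (hS28 : bsdTriple_of_hasCM_of_L_one_ne_zero)
    (W : WeierstrassCurve ℚ) (hW : W = ⟨0, 0, 0, (-310500), (-139239000)⟩) (hLW : W.entireLFunction 1 ≠ 0)
    (hs : shaAn W = ((1 : ℕ) : ℚ))
    (A : WeierstrassCurve ℚ) (hA : A = ⟨0, 0, 0, 0, 800⟩)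
    (hcong : ∃ e : W.geomTorsion ((5 : ℕ) : ℤ) ≃+ A.geomTorsion ((5 : ℕ) : ℤ),
      ∀ (σ : absoluteGaloisGroup ℚ) (P : W.geomTorsion ((5 : ℕ) : ℤ)), e (σ • P) = σ • e P)
    (hr : A.analyticRank = 0) (hm : shaAn A = ((1 : ℕ) : ℂ)) (htam : ¬ 5 ∣ A.tamagawaProduct)
    (S : Finset (HeightOneSpectrum (𝓞 ℚ))) (hS : ∀ v ∉ S, (((5 : ℕ) : ℕ) : 𝓞 ℚ) ∉ v.asIdeal ∧ A.HasGoodReductionAt v)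
    (hlocp : ∀ v ∈ S, (((5 : ℕ) : ℕ) : 𝓞 ℚ) ∈ v.asIdeal →
      ∀ x : A.geomPrimaryTorsion 5, 5 • x = 0 → (∀ d ∈ decomp v, d • x = x) → x = 0) :
    ∀ (V : WeierstrassCurve ℚ) [V.IsElliptic] [V.IsGloballyMinimal] [Fact (5 : ℕ).Prime],
      (∃ C : VariableChange ℚ, C • W.quadraticTwist (5) = V) →
      V.HasGoodReductionAtPrime 5 → V.frobeniusTrace 5 = 0 →
      (∀ {N : ℕ} [NeZero N] {f : CuspForm (Gamma0 N) 2}, IsNewformOf V f →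
        ∀ (ϖ : ℚ), (if Even (5 / 2) then (ϖ : ℝ) * V.realPeriodRat = plusPeriod f
            else (ϖ : ℝ) * V.imaginaryPeriodRat = minusPeriod f) →
        ∀ (Lη : IwasawaAlgebra 5), IsQuadraticBranchPlusLFunction f 5 ϖ Lη → HasUnitContent Lη) →
        QuadraticBranchPlusEtaMainConjectureAt V 5 := by
  subst hW; subst hA
  intro V _ _ _ hC hgood hap hμan
  obtain ⟨C, hCV⟩ := hC
  haveI := isElliptic_417600fp1
  haveI := isGloballyMinimal_417600fp1
  haveI := isElliptic_A14400
  haveI := isGloballyMinimal_A14400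
  have hD : ((-1 : ℚ) ^ ((5 : ℕ) / 2) * ((5 : ℕ) : ℚ)) = 5 := by norm_num
  exact EtaFineRoad.quadraticBranchPlusEtaMainConjectureAt_of_congruent_cmUnitAnchor_of_shaAn_unit _ 5 hPT hmod hGZK h22 h41
    hKO h6273 hS28 V C (le_refl 5) (by rw [hD]; exact hCV) hgood hap hLW (q := ((1 : ℕ) : ℚ)) (by exact_mod_cast hs) (by simp) hμan
    _ hcong hasCM_A14400 hr hm (by decide) htam S hS hlocp

set_option maxRecDepth 100000 in
/-- **(C1⁺_η) at `p = 5` for every good `a_5 = 0` model `V` of the `5`-twist of `417600gp1`** (`N = 417600`, non-CM, `Im ρ̄ = C_ns⁺(5)`;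
Cremona: `r_an = 1`; PARI `λ(L_5⁺(V,η,X)) = 1`, `μ = 0` (k8eta-c2 g3/g4) so `(L_5⁺(V,η,X)) = (X)` — a PRIME-`L` rank-`1` row) through the
rank-`0` CM sibling `A = [0, 0, 0, 0, 800]` of its class: the row is the point `(λ:μ) = (60:1)` of the indirect family `X_{14400l1}^{(2)}(5)` and `A` the point point `(0:1)` of the direct family `X_{14400l1}(5)` of Fisher's
families of `14400l1`, so `W[5] ≅ 14400l1[5] ≅ A[5]` BY THEOREM (displayed `hcong`); `A`: `r_an = 0`, `#Ш_an = 1`, `Tam = 2`, `#A(ℚ)_tors = 1`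
(displayed; kit j281329), local test at `5` displayed; the row's `r_an(W) = 1` (`h1`) and `(L_5⁺) = (X)` (`hX`) displayed; the analytic
`μ` is automatic on a prime-`L` row. Statement (A) at the anchor is the TREE THEOREM `WildFineSelmerCMFineUnitAnchor.conjA_rat_of_cmFineUnitData_tamagawa`
(mod `hS28 hmod`) — no Hatley–Lei, no Deo–Ray–Sujatha certificate, no «`Ш[5] = 0`» at a rank-`1` anchor. Per-row instance of
`EtaFineRoad.quadraticBranchPlusEtaMainConjectureAt_of_span_eq_span_X_of_congruent_cmUnitAnchor`; CONDITIONAL on `hGZK h22 h41 h6273 hS28 hmod`;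
nothing booked. [cite: Fisher2012Hessian, Thm. 13.2] [cite: Fisher2013QuinticI, Thm. 5.8] [cite: LimSujatha2018, §3 Prop. 3.2]
[cite: BurungaleFlach2024, Thm. 1.1 and Cor. 2] [cite: Kobayashi2003, §4 and Thm. 4.1 first display (p. 8)] [cite: Cremona1997, Table 1 (label 417600gp1)] -/
theorem etaMC_r1_417600gp1_5_cmUnitSibling (hmod : hasEntireLFunction_rat)
    (hGZK : rank_eq_analyticRank_of_analyticRank_le_one)
    (h22 : Kobayashi2003.thm22_etaSignedSelmerDual_finite_torsion)
    (h41 : Kobayashi2003.thm41_plusEtaCharIdeal_dvd)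
    (h6273 : Kobayashi2003.thm62_63_73_etaColemanPoitouTate) (hS28 : bsdTriple_of_hasCM_of_L_one_ne_zero)
    (W : WeierstrassCurve ℚ) (hW : W = ⟨0, 0, 0, (-34500), 5157000⟩)
    (A : WeierstrassCurve ℚ) (hA : A = ⟨0, 0, 0, 0, 800⟩)
    (hcong : ∃ e : W.geomTorsion ((5 : ℕ) : ℤ) ≃+ A.geomTorsion ((5 : ℕ) : ℤ),
      ∀ (σ : absoluteGaloisGroup ℚ) (P : W.geomTorsion ((5 : ℕ) : ℤ)), e (σ • P) = σ • e P)
    (hr : A.analyticRank = 0) (hm : shaAn A = ((1 : ℕ) : ℂ)) (htam : ¬ 5 ∣ A.tamagawaProduct)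
    (S : Finset (HeightOneSpectrum (𝓞 ℚ))) (hS : ∀ v ∉ S, (((5 : ℕ) : ℕ) : 𝓞 ℚ) ∉ v.asIdeal ∧ A.HasGoodReductionAt v)
    (hlocp : ∀ v ∈ S, (((5 : ℕ) : ℕ) : 𝓞 ℚ) ∈ v.asIdeal →
      ∀ x : A.geomPrimaryTorsion 5, 5 • x = 0 → (∀ d ∈ decomp v, d • x = x) → x = 0) :
    ∀ (V : WeierstrassCurve ℚ) [V.IsElliptic] [V.IsGloballyMinimal] [Fact (5 : ℕ).Prime],
      (∃ C : VariableChange ℚ, C • W.quadraticTwist (5) = V) →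
      V.HasGoodReductionAtPrime 5 → V.frobeniusTrace 5 = 0 → W.analyticRank = 1 →
      (∀ {N : ℕ} [NeZero N] {f : CuspForm (Gamma0 N) 2}, IsNewformOf V f →
        ∀ (ϖ : ℚ), (if Even (5 / 2) then (ϖ : ℝ) * V.realPeriodRat = plusPeriod f
            else (ϖ : ℝ) * V.imaginaryPeriodRat = minusPeriod f) →
        ∀ (Lη : IwasawaAlgebra 5), IsQuadraticBranchPlusLFunction f 5 ϖ Lη →
          Ideal.span {Lη} = Ideal.span {(PowerSeries.X : IwasawaAlgebra 5)}) →
        QuadraticBranchPlusEtaMainConjectureAt V 5 := by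
  subst hW; subst hA
  intro V _ _ _ hC hgood hap h1 hX
  obtain ⟨C, hCV⟩ := hC
  haveI := isElliptic_417600gp1
  haveI := isGloballyMinimal_417600gp1
  haveI := isElliptic_A14400
  haveI := isGloballyMinimal_A14400
  have hD : ((-1 : ℚ) ^ ((5 : ℕ) / 2) * ((5 : ℕ) : ℚ)) = 5 := by norm_num
  exact EtaFineRoad.quadraticBranchPlusEtaMainConjectureAt_of_span_eq_span_X_of_congruent_cmUnitAnchor _ 5 h22 h41 h6273 hS28
    hmod V C (le_refl 5) (by rw [hD]; exact hCV) hgood hap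
    (EtaPrimeRoad.not_finite_selmer_of_analyticRank_eq_one _ (p := 5) hGZK h1) hX
    _ hcong hasCM_A14400 hr hm (by decide) htam S hS hlocp

end EtaFineRoadRecords

end Summit.BirchSwinnertonDyer.BirchSwinnertonDyer.Theorems

end
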